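import Literature.Combinatorics.Additive.ProductSpaceOperators
import Literature.Computability.Complexity.HypercontractivityTwoQ
import HarnessLib

/-!
# Sharp hypercontractivity for global functions on a product space, given the hypercontractive estimate: KLM Thm 4.5, Lemma 4.6, Lemma 4.9

Source: N. Keller, N. Lifshitz, O. Marcus, *Sharp hypercontractivity for global functions*,
arXiv:2307.01356 = J. Eur. Math. Soc. 2026 [KellerLifshitzMarcus2023], §4.2 (Def. 4.4, Thm. 4.5,
Lemma 4.6) and §4.3 (Def. 4.8, Lemma 4.9), pp. 33–35 of the arXiv version (read first-hand; cell
pnp-psdrank, lit g23). Third file of the programme discharging the tree's named fact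
`ProductSpace.KellerLifshitzMarcus2023_thm54` (KLM Thm 5.4, the level-`d` inequality for biglobal
functions on `[m]^N`); it is written for a GENERAL finite product space `Π_i α i` with the uniform measure,
on top of `ProductSpaceOperators.lean` (operators `E_A`, `f^{=T}`, `L_S`, `T_{ρ,A}`, `D_{S,y}`).

* expectation `mean`, `l2sq f = ‖f‖₂²`, `lqPow q f = ‖f‖_q^q`, `l2n f = ‖f‖₂`; Parseval
  `l2sq_eq_sum_l2sq_esPart`, `mean_mul_esLevel`, the `L²`-contraction of `T_ρ`, the Fubini identity
  `mean_l2sq_deriv` (`E_y ‖D_{S,y} g‖₂² = ‖L_S g‖₂²`), and **Lemma 4.6** `sum_l2sq_lap_noiseOn`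
  (`∑_S ‖L_S T_{1/√2} f‖₂² = ‖f‖₂²`);
* `IsL2Global r γ f` (Def. 4.4: `‖D_{S,x} f‖₂ ≤ r^{|S|} γ` for all `S`), `IsL1GlobalD`/`IsL2GlobalD`
  (Def. 4.8, depth `d`), `IsRestrGlobal` (the restriction-based hypothesis of Thm 5.4 = the tree's
  `IsBiglobalX` in expectation normalisation) and **Lemma 4.9** `isL1GlobalD_of_isRestrGlobal` /
  `isL2GlobalD_of_isRestrGlobal` (restriction-global ⇒ `(2r, γ, d)`-derivative-global);
* `klmBeta q ρ = ρ (1 + 2(q-2)/log(1/ρ))` and the PREDICATE `HcEstimate q ρ f` — the conclusion of KLM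
  **Thm 4.1** for the function `f` (`‖T_{ρ/√q} f‖_q^q ≤ ∑_S β^{q|S|} q^{-q|S|/2} E_x ‖D_{S,x} f‖₂^q`); it is
  PROVED for every `f` on `[m]^N` in `ProductSpaceHypercontractivity.lean` (Rademacher encodings) and
  enters here only as an explicit hypothesis of
* **Thm 4.5** `lqPow_noiseOn_le_of_isL2Global`: for an `(r,γ)`-`L²`-global `f`, `ρ̃ ≤ 1/3` and
  `β(ρ̃) ≤ √q (r/√2)^{-(q-2)/q}`, `‖T_{ρ̃/√(2q)} f‖_q^q ≤ ‖f‖₂² γ^{q-2}`, proved exactly as printed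
  (Thm 4.1 for `f̃ = T_{1/√2} f`, Lemma 2.2, contraction, the bracket `≤ 1`, Lemma 4.6).

All proved, no named facts, no instances, no notation; standard axioms. WHAT THIS IS NOT: Thm 4.1 itself
is not proved here (see `HcEstimate`); nothing about `S_n`, matchings or psd rank; no P-vs-NP content.
-/

noncomputable section

namespace Literature.Combinatorics.Additive.ProductSpace

open Finset

variable {ι : Type*} [Fintype ι] [DecidableEq ι] {α : ι → Type*} [∀ i, Fintype (α i)]

/-! ## Expectations and norms -/

/-- The expectation `E f = |X|⁻¹ ∑_x f(x)` (uniform measure). [cite: KellerLifshitzMarcus2023, §2.2] -/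
def mean (f : ((i : ι) → α i) → ℝ) : ℝ := (∑ x, f x) / cardX α

/-- `‖f‖₂²`. [cite: KellerLifshitzMarcus2023, §2.2 ("`L²(Ωⁿ, μ)`")] -/
def l2sq (f : ((i : ι) → α i) → ℝ) : ℝ := mean fun x => f x ^ 2

/-- `‖f‖_q^q = E|f|^q`. [cite: KellerLifshitzMarcus2023, §2.2 (the `L^q` norms)] -/
def lqPow (q : ℝ) (f : ((i : ι) → α i) → ℝ) : ℝ := mean fun x => |f x| ^ q

/-- `‖f‖₂ = (E f²)^{1/2}`. [cite: KellerLifshitzMarcus2023, §2.2] -/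
def l2n (f : ((i : ι) → α i) → ℝ) : ℝ := Real.sqrt (l2sq f)

/-- [cite: KellerLifshitzMarcus2023, §2.2] -/
theorem mean_add (f g : ((i : ι) → α i) → ℝ) : mean (fun x => f x + g x) = mean f + mean g := by
  unfold mean; rw [Finset.sum_add_distrib, add_div]

/-- [cite: KellerLifshitzMarcus2023, §2.2] -/
theorem mean_sub (f g : ((i : ι) → α i) → ℝ) : mean (fun x => f x - g x) = mean f - mean g := by
  unfold mean; rw [Finset.sum_sub_distrib, sub_div]

/-- [cite: KellerLifshitzMarcus2023, §2.2] -/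
theorem mean_smul (c : ℝ) (f : ((i : ι) → α i) → ℝ) : mean (fun x => c * f x) = c * mean f := by
  unfold mean; rw [← Finset.mul_sum, mul_div_assoc]

/-- [cite: KellerLifshitzMarcus2023, §2.2] -/
theorem mean_finset_sum {κ : Type*} (s : Finset κ) (F : κ → ((i : ι) → α i) → ℝ) :
    mean (fun x => ∑ k ∈ s, F k x) = ∑ k ∈ s, mean (F k) := by
  unfold mean; rw [Finset.sum_comm, Finset.sum_div]

/-- [cite: KellerLifshitzMarcus2023, §2.2] -/
theorem mean_mono {f g : ((i : ι) → α i) → ℝ} (h : ∀ x, f x ≤ g x) [∀ i, Nonempty (α i)] :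
    mean f ≤ mean g :=
  div_le_div_of_nonneg_right (Finset.sum_le_sum fun x _ => h x) cardX_pos.le

/-- [cite: KellerLifshitzMarcus2023, §2.2] -/
theorem mean_nonneg {f : ((i : ι) → α i) → ℝ} (h : ∀ x, 0 ≤ f x) [∀ i, Nonempty (α i)] : 0 ≤ mean f :=
  div_nonneg (Finset.sum_nonneg fun x _ => h x) cardX_pos.le

/-- [cite: KellerLifshitzMarcus2023, §2.2] -/
theorem mean_const [∀ i, Nonempty (α i)] (c : ℝ) : mean (fun _ : (i : ι) → α i => c) = c := by
  unfold mean
  have hc : cardX α ≠ 0 := cardX_pos.ne'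
  rw [Finset.sum_const, Finset.card_univ, nsmul_eq_mul, ← cardX]
  field_simp

/-- `|E f| ≤ E|f|`. [cite: KellerLifshitzMarcus2023, §2.2] -/
theorem abs_mean_le_mean_abs [∀ i, Nonempty (α i)] (f : ((i : ι) → α i) → ℝ) :
    |mean f| ≤ mean fun x => |f x| := by
  unfold mean
  rw [abs_div, abs_of_pos cardX_pos]
  exact div_le_div_of_nonneg_right (Finset.abs_sum_le_sum_abs _ _) cardX_pos.le

/-- `E (E_A f) = E f`. [cite: KellerLifshitzMarcus2023, §2.2] -/
theorem mean_condAvg [∀ i, Nonempty (α i)] (A : Finset ι) (f : ((i : ι) → α i) → ℝ) :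
    mean (condAvg A f) = mean f := by
  unfold mean; rw [sum_condAvg]

/-- **Fubini for restrictions**: `E_y E_x [g(S.piecewise y x)] = E g`, i.e. averaging a restriction over the
frozen values gives the full average. [cite: KellerLifshitzMarcus2023, §2.2] -/
theorem mean_mean_restr [∀ i, Nonempty (α i)] (S : Finset ι) (g : ((i : ι) → α i) → ℝ) :
    mean (fun y => mean (restr S y g)) = mean g := by
  unfold mean restr
  rw [← Finset.sum_div, div_div]
  have h := sum_sum_piecewise S g
  rw [Finset.sum_comm] at h
  rw [h, mul_comm, mul_div_mul_right _ _ cardX_pos.ne']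

/-- [cite: KellerLifshitzMarcus2023, §2.2] -/
theorem l2sq_nonneg [∀ i, Nonempty (α i)] (f : ((i : ι) → α i) → ℝ) : 0 ≤ l2sq f :=
  mean_nonneg fun _ => sq_nonneg _

/-- [cite: KellerLifshitzMarcus2023, §2.2] -/
theorem lqPow_nonneg [∀ i, Nonempty (α i)] (q : ℝ) (f : ((i : ι) → α i) → ℝ) : 0 ≤ lqPow q f :=
  mean_nonneg fun _ => Real.rpow_nonneg (abs_nonneg _) _

/-- `‖f‖₂² = E|f|²` is the case `q = 2` of `lqPow`. [cite: KellerLifshitzMarcus2023, §2.2] -/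
theorem lqPow_two (f : ((i : ι) → α i) → ℝ) : lqPow 2 f = l2sq f := by
  unfold lqPow l2sq
  congr 1; funext x
  rw [Real.rpow_two, sq_abs]

/-- `‖c f‖₂² = c² ‖f‖₂²`. [cite: KellerLifshitzMarcus2023, §2.2] -/
theorem l2sq_smul (c : ℝ) (f : ((i : ι) → α i) → ℝ) : l2sq (fun x => c * f x) = c ^ 2 * l2sq f := by
  unfold l2sq; rw [← mean_smul]; congr 1; funext x; ring

/-- `‖c f‖_q^q = |c|^q ‖f‖_q^q`. [cite: KellerLifshitzMarcus2023, §2.2] -/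
theorem lqPow_smul {q : ℝ} (c : ℝ) (f : ((i : ι) → α i) → ℝ) :
    lqPow q (fun x => c * f x) = |c| ^ q * lqPow q f := by
  unfold lqPow; rw [← mean_smul]; congr 1; funext x
  rw [abs_mul, Real.mul_rpow (abs_nonneg _) (abs_nonneg _)]

/-- The mean of a product in terms of the sum: `E[f g] = |X|⁻¹ ∑ f g`. [cite: KellerLifshitzMarcus2023, §2.2] -/
theorem mean_mul_eq (f g : ((i : ι) → α i) → ℝ) : mean (fun x => f x * g x) = (∑ x, f x * g x) / cardX α := rfl

/-! ## Parseval for the Efron–Stein decomposition -/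

/-- `E[f · g^{=T}] = E[f^{=T} g^{=T}]`. [cite: KellerLifshitzMarcus2023, §2.2 (orthogonality of the `V^{=T}`)] -/
theorem mean_mul_esPart [∀ i, Nonempty (α i)] (T : Finset ι) (f g : ((i : ι) → α i) → ℝ) :
    mean (fun x => f x * esPart T g x) = mean (fun x => esPart T f x * esPart T g x) := by
  unfold mean
  congr 1
  conv_lhs => rw [show (fun x => f x * esPart T g x) = fun x => (∑ T', esPart T' f x) * esPart T g x from
    funext fun x => by rw [sum_esPart]]
  simp_rw [Finset.sum_mul]
  rw [Finset.sum_comm, Finset.sum_eq_single T]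
  · intro T' _ hT'
    exact sum_esPart_mul_esPart hT' f g
  · intro h; exact absurd (Finset.mem_univ T) h

/-- **Parseval**: `E[f g] = ∑_T E[f^{=T} g^{=T}]`. [cite: KellerLifshitzMarcus2023, §2.2] -/
theorem mean_mul_eq_sum_esPart [∀ i, Nonempty (α i)] (f g : ((i : ι) → α i) → ℝ) :
    mean (fun x => f x * g x) = ∑ T : Finset ι, mean (fun x => esPart T f x * esPart T g x) := by
  conv_lhs => rw [show (fun x => f x * g x) = fun x => ∑ T : Finset ι, f x * esPart T g x from
    funext fun x => by rw [← Finset.mul_sum, sum_esPart]]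
  rw [mean_finset_sum]
  exact Finset.sum_congr rfl fun T _ => mean_mul_esPart T f g

/-- **Parseval**: `‖f‖₂² = ∑_T ‖f^{=T}‖₂²`. [cite: KellerLifshitzMarcus2023, §2.2] -/
theorem l2sq_eq_sum_l2sq_esPart [∀ i, Nonempty (α i)] (f : ((i : ι) → α i) → ℝ) :
    l2sq f = ∑ T : Finset ι, l2sq (esPart T f) := by
  unfold l2sq
  simp_rw [sq]
  exact mean_mul_eq_sum_esPart f f

/-- `⟨f, f^{=d}⟩ = ‖f^{=d}‖₂²`. [cite: KellerLifshitzMarcus2023, Lemma 5.1 (proof: "`‖f^{=d}‖₂² = ⟨f, f^{=d}⟩`")] -/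
theorem mean_mul_esLevel [∀ i, Nonempty (α i)] (d : ℕ) (f : ((i : ι) → α i) → ℝ) :
    mean (fun x => f x * esLevel d f x) = l2sq (esLevel d f) := by
  unfold l2sq
  simp_rw [sq]
  rw [mean_mul_eq_sum_esPart, mean_mul_eq_sum_esPart]
  refine Finset.sum_congr rfl fun T _ => ?_
  rw [esPart_esLevel]
  split_ifs with h
  · rfl
  · simp

/-- `‖T_{ρ,A} f‖₂² = ∑_T ρ^{2|T∩A|} ‖f^{=T}‖₂²`. [cite: KellerLifshitzMarcus2023, §2.2 (eq. (2.1))] -/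
theorem l2sq_noiseOn [∀ i, Nonempty (α i)] (ρ : ℝ) (A : Finset ι) (f : ((i : ι) → α i) → ℝ) :
    l2sq (noiseOn ρ A f) = ∑ T : Finset ι, ρ ^ (2 * (T ∩ A).card) * l2sq (esPart T f) := by
  rw [l2sq_eq_sum_l2sq_esPart]
  refine Finset.sum_congr rfl fun T _ => ?_
  rw [esPart_noiseOn, l2sq_smul, ← pow_mul, mul_comm 2]

/-- **`T_ρ` is an `L²`-contraction** (`|ρ| ≤ 1`). [cite: KellerLifshitzMarcus2023, Thm. 4.5 (proof: "`T_{1/√2}` is a contraction")] -/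
theorem l2sq_noiseOn_le [∀ i, Nonempty (α i)] {ρ : ℝ} (hρ : |ρ| ≤ 1) (A : Finset ι)
    (f : ((i : ι) → α i) → ℝ) : l2sq (noiseOn ρ A f) ≤ l2sq f := by
  rw [l2sq_noiseOn, l2sq_eq_sum_l2sq_esPart f]
  refine Finset.sum_le_sum fun T _ => ?_
  have h1 : ρ ^ (2 * (T ∩ A).card) ≤ 1 := by
    rw [pow_mul, ← sq_abs]
    exact pow_le_one₀ (sq_nonneg _) (by nlinarith [abs_nonneg ρ])
  have h2 : 0 ≤ ρ ^ (2 * (T ∩ A).card) := by rw [pow_mul]; positivity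
  nlinarith [l2sq_nonneg (esPart T f)]

/-- `‖L_S g‖₂² = ∑_{T ⊇ S} ‖g^{=T}‖₂²`. [cite: KellerLifshitzMarcus2023, Lemma 4.6 (proof)] -/
theorem l2sq_lap [∀ i, Nonempty (α i)] (S : Finset ι) (g : ((i : ι) → α i) → ℝ) :
    l2sq (lap S g) = ∑ T : Finset ι, if S ⊆ T then l2sq (esPart T g) else 0 := by
  rw [l2sq_eq_sum_l2sq_esPart]
  refine Finset.sum_congr rfl fun T _ => ?_
  rw [esPart_lap]
  split_ifs
  · rfl
  · unfold l2sq; simp [mean]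

/-- **Fubini for derivatives**: `E_y ‖D_{S,y} g‖₂² = ‖L_S g‖₂²`. [cite: KellerLifshitzMarcus2023, Thm. 4.5 (proof, last display: "`E_x ‖D_{S,x} T f‖₂² = ‖L_S T f‖₂²`")] -/
theorem mean_l2sq_deriv [∀ i, Nonempty (α i)] (S : Finset ι) (g : ((i : ι) → α i) → ℝ) :
    mean (fun y => l2sq (deriv S y g)) = l2sq (lap S g) := by
  unfold deriv l2sq
  have h := mean_mean_restr S (fun x => lap S g x ^ 2)
  refine Eq.trans ?_ h
  rfl

/-- **KLM Lemma 4.6**: `∑_S ‖L_S T_{1/√2} f‖₂² = ‖f‖₂²`. [cite: KellerLifshitzMarcus2023, Lemma 4.6] -/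
theorem sum_l2sq_lap_noiseOn [∀ i, Nonempty (α i)] (f : ((i : ι) → α i) → ℝ) :
    ∑ S : Finset ι, l2sq (lap S (noiseOn (1 / Real.sqrt 2) univ f)) = l2sq f := by
  simp_rw [l2sq_lap, esPart_noiseOn, l2sq_smul, Finset.inter_univ]
  -- `∑_S ∑_T [S ⊆ T] 2^{-|T|} ‖f^{=T}‖² = ∑_T 2^{-|T|} #{S ⊆ T} ‖f^{=T}‖² = ∑_T ‖f^{=T}‖²`
  rw [Finset.sum_comm, l2sq_eq_sum_l2sq_esPart f]
  refine Finset.sum_congr rfl fun T _ => ?_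
  rw [← Finset.sum_filter]
  have hfilter : (univ : Finset (Finset ι)).filter (fun S => S ⊆ T) = T.powerset := by
    ext S; simp
  rw [hfilter, Finset.sum_const, Finset.card_powerset, nsmul_eq_mul]
  have hsq : (((1 : ℝ) / Real.sqrt 2) ^ T.card) ^ 2 = ((2 : ℝ) ^ T.card)⁻¹ := by
    rw [← pow_mul, mul_comm, pow_mul, div_pow, one_pow, Real.sq_sqrt (by norm_num : (0 : ℝ) ≤ 2),
      one_div, inv_pow]
  rw [hsq, ← mul_assoc]
  push_cast
  rw [mul_inv_cancel₀ (by positivity), one_mul]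

/-! ## Globalness notions (KLM Def. 4.4, Def. 4.8) -/

/-- **`(r, γ)`-`L²`-global** (KLM Def. 4.4): `‖D_{S,x} f‖₂ ≤ r^{|S|} γ` for all `S ⊆ [n]` and all `x`
(squared form). [cite: KellerLifshitzMarcus2023, Def. 4.4] -/
def IsL2Global (r γ : ℝ) (f : ((i : ι) → α i) → ℝ) : Prop :=
  ∀ (S : Finset ι) (y : (i : ι) → α i), l2sq (deriv S y f) ≤ (r ^ S.card * γ) ^ 2

/-- **`(r, γ, d)`-`L¹`-global** (KLM Def. 4.8, `p = 1`): `‖D_{S,x} f‖₁ ≤ r^{|S|} γ` for `|S| ≤ d`.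
[cite: KellerLifshitzMarcus2023, Def. 4.8] -/
def IsL1GlobalD (r γ : ℝ) (d : ℕ) (f : ((i : ι) → α i) → ℝ) : Prop :=
  ∀ S : Finset ι, S.card ≤ d → ∀ y : (i : ι) → α i, mean (fun x => |deriv S y f x|) ≤ r ^ S.card * γ

/-- **`(r, γ, d)`-`L²`-global** (KLM Def. 4.8, `p = 2`, squared form): `‖D_{S,x} f‖₂ ≤ r^{|S|} γ` for `|S| ≤ d`.
[cite: KellerLifshitzMarcus2023, Def. 4.8] -/
def IsL2GlobalD (r γ : ℝ) (d : ℕ) (f : ((i : ι) → α i) → ℝ) : Prop :=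
  ∀ S : Finset ι, S.card ≤ d → ∀ y : (i : ι) → α i, l2sq (deriv S y f) ≤ (r ^ S.card * γ) ^ 2

/-- **Restriction-based globalness** (the hypothesis of KLM Thm 5.4 / Keevash–Lifshitz Def. 1.4:
`‖f_{S→x}‖₁ ≤ r^{|S|} γ₁` and `‖f_{S→x}‖₂ ≤ r^{|S|} γ₂` for `|S| ≤ d`, expectation norms over `Ω^{Sᶜ}` —
written with `restr S x f` on all of `X`, which has the same norms).
[cite: KellerLifshitzMarcus2023, Thm. 5.4 (hypothesis)] -/
def IsRestrGlobal (r γ₁ γ₂ : ℝ) (d : ℕ) (f : ((i : ι) → α i) → ℝ) : Prop :=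
  ∀ S : Finset ι, S.card ≤ d → ∀ y : (i : ι) → α i,
    mean (fun x => |restr S y f x|) ≤ r ^ S.card * γ₁ ∧ l2sq (restr S y f) ≤ (r ^ S.card * γ₂) ^ 2

/-! ## The hypercontractive estimate (statement of KLM Thm 4.1) -/

/-- **`β = ρ (1 + 2(q-2)/log(1/ρ))`** (the constant of KLM Prop. 3.1 / Thm 4.1).
[cite: KellerLifshitzMarcus2023, Prop. 3.1] -/
def klmBeta (q ρ : ℝ) : ℝ := ρ * (1 + 2 * (q - 2) / Real.log (1 / ρ))

/-- [cite: KellerLifshitzMarcus2023, Prop. 3.1] -/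
theorem klmBeta_nonneg {q ρ : ℝ} (hq : 2 ≤ q) (hρ0 : 0 ≤ ρ) (hρ1 : ρ ≤ 1) : 0 ≤ klmBeta q ρ := by
  unfold klmBeta
  refine mul_nonneg hρ0 (add_nonneg zero_le_one (div_nonneg (by linarith) ?_))
  rcases hρ0.eq_or_lt with h | h
  · rw [← h]; simp
  · exact Real.log_nonneg (by rw [le_div_iff₀ h]; linarith)

/-- **The hypercontractive estimate for `f`** — the conclusion of KLM **Thm 4.1** for the function `f` and
the parameters `(q, ρ)`: `‖T_{ρ/√q} f‖_q^q ≤ ∑_{S ⊆ [n]} β^{q|S|} q^{-q|S|/2} E_{x} ‖D_{S,x} f‖₂^q` with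
`β = klmBeta q ρ` (here `E_x` over all of `X`, the derivative depending on `x_S` only). A PREDICATE on `f`
(used as an explicit hypothesis below); it is proved for every `f : [m]^N → ℝ`, `q > 2`, `0 < ρ ≤ 1/3` in
`ProductSpaceHypercontractivity.lean`. [cite: KellerLifshitzMarcus2023, Thm. 4.1] -/
def HcEstimate (q ρ : ℝ) (f : ((i : ι) → α i) → ℝ) : Prop :=
  lqPow q (noiseOn (ρ / Real.sqrt q) univ f) ≤
    ∑ S : Finset ι, klmBeta q ρ ^ (q * S.card) * q ^ (-(q * S.card) / 2) *
      mean (fun y => l2sq (deriv S y f) ^ (q / 2))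

/-! ## KLM Theorem 4.5 -/

/-- The bracket of KLM (4.1)–(4.3): if `β ≤ √q (r/√2)^{-(q-2)/q}` then
`β^{q} q^{-q/2} ((r²/2)^{(q-2)/2}) ≤ 1` (per coordinate of `S`).
[cite: KellerLifshitzMarcus2023, Thm. 4.5 (proof: "By (4.1), we have `(β/√q)^q (r/√2)^{q-2} ≤ 1`")] -/
theorem bracket_le_one {q r β : ℝ} (hq : 2 < q) (hr : 0 < r) (hβ0 : 0 ≤ β)
    (hβ : β ≤ Real.sqrt q * (r / Real.sqrt 2) ^ (-(q - 2) / q)) :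
    β ^ q * q ^ (-q / 2) * (r ^ 2 / 2) ^ ((q - 2) / 2) ≤ 1 := by
  have hq0 : 0 < q := by linarith
  have hs2 : 0 < Real.sqrt 2 := Real.sqrt_pos.2 (by norm_num)
  have hrs : 0 < r / Real.sqrt 2 := div_pos hr hs2
  -- raise `β ≤ √q · (r/√2)^{-(q-2)/q}` to the power `q`
  have h1 : β ^ q ≤ (Real.sqrt q * (r / Real.sqrt 2) ^ (-(q - 2) / q)) ^ q :=
    Real.rpow_le_rpow hβ0 hβ hq0.le
  have h2 : (Real.sqrt q * (r / Real.sqrt 2) ^ (-(q - 2) / q)) ^ q =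
      q ^ (q / 2) * (r / Real.sqrt 2) ^ (-(q - 2)) := by
    rw [Real.mul_rpow (Real.sqrt_nonneg _) (Real.rpow_nonneg hrs.le _), Real.sqrt_eq_rpow,
      ← Real.rpow_mul hq0.le, ← Real.rpow_mul hrs.le]
    congr 1
    · congr 1; ring
    · congr 1; field_simp
  have h3 : (r ^ 2 / 2) ^ ((q - 2) / 2) = (r / Real.sqrt 2) ^ (q - 2) := by
    have : r ^ 2 / 2 = (r / Real.sqrt 2) ^ (2 : ℝ) := by
      rw [Real.rpow_two, div_pow, Real.sq_sqrt (by norm_num : (0 : ℝ) ≤ 2)]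
    rw [this, ← Real.rpow_mul hrs.le]
    congr 1; ring
  rw [h3]
  calc β ^ q * q ^ (-q / 2) * (r / Real.sqrt 2) ^ (q - 2)
      ≤ (q ^ (q / 2) * (r / Real.sqrt 2) ^ (-(q - 2))) * q ^ (-q / 2) * (r / Real.sqrt 2) ^ (q - 2) := by
        gcongr
        · exact h1.trans_eq h2
    _ = (q ^ (q / 2) * q ^ (-q / 2)) * ((r / Real.sqrt 2) ^ (-(q - 2)) * (r / Real.sqrt 2) ^ (q - 2)) := by
        ring
    _ = 1 := by
        rw [← Real.rpow_add hq0, ← Real.rpow_add hrs, show q / 2 + -q / 2 = 0 by ring,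
          show -(q - 2) + (q - 2) = 0 by ring, Real.rpow_zero, Real.rpow_zero, mul_one]

/-- For `x ≥ 0` and `q ≥ 2`: `x^{q/2} = x^{(q-2)/2} · x`. [folklore] -/
private theorem rpow_half_split {x q : ℝ} (hx : 0 ≤ x) (hq : 2 ≤ q) :
    x ^ (q / 2) = x ^ ((q - 2) / 2) * x := by
  rcases hx.eq_or_lt with h | h
  · rw [← h, Real.zero_rpow (by linarith), mul_zero]
  · conv_rhs => rw [show x = x ^ (1 : ℝ) by rw [Real.rpow_one]]
    rw [← Real.rpow_mul hx, ← Real.rpow_add h]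
    congr 1; ring

/-- Exponent bookkeeping for the coefficients in the proof of Thm 4.5. [folklore] -/
private theorem coef_bookkeeping {β q r γ : ℝ} (hβ : 0 ≤ β) (hq : 0 < q) (hr : 0 < r) (hγ : 0 < γ) (n : ℕ) :
    β ^ (q * n) * q ^ (-(q * n) / 2) * ((r ^ 2 / 2) ^ n * γ ^ 2) ^ ((q - 2) / 2) =
      (β ^ q * q ^ (-q / 2) * (r ^ 2 / 2) ^ ((q - 2) / 2)) ^ n * γ ^ (q - 2) := by
  have hr2 : 0 ≤ r ^ 2 / 2 := by positivity
  have e1 : β ^ (q * n) = (β ^ q) ^ n := by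
    rw [Real.rpow_mul hβ, Real.rpow_natCast]
  have e2 : q ^ (-(q * n) / 2) = (q ^ (-q / 2)) ^ n := by
    rw [show -(q * (n : ℝ)) / 2 = (-q / 2) * n by ring, Real.rpow_mul hq.le, Real.rpow_natCast]
  have e3 : ((r ^ 2 / 2) ^ n * γ ^ 2) ^ ((q - 2) / 2) =
      ((r ^ 2 / 2) ^ ((q - 2) / 2)) ^ n * γ ^ (q - 2) := by
    rw [Real.mul_rpow (by positivity) (by positivity)]
    congr 1
    · rw [← Real.rpow_natCast (r ^ 2 / 2) n, ← Real.rpow_mul hr2, mul_comm, Real.rpow_mul hr2,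
        Real.rpow_natCast]
    · rw [← Real.rpow_natCast γ 2, ← Real.rpow_mul hγ.le]
      congr 1; push_cast; ring
  rw [e1, e2, e3, mul_pow, mul_pow]
  ring

/-- **KLM Theorem 4.5 (sharp hypercontractivity for `L²`-global functions), given the hypercontractive
estimate**: let `f` be `(r, γ)`-`L²`-global, `q > 2`, `0 < ρ̃ ≤ 1/3` and suppose
`β(ρ̃) ≤ √q (r/√2)^{-(q-2)/q}` (condition (4.1)); if Thm 4.1 holds for `f̃ = T_{1/√2} f` at `(q, ρ̃)` then
`‖T_{ρ̃/√(2q)} f‖_q^q ≤ ‖f‖₂² γ^{q-2}`. Proof as printed: `T_{ρ̃/√(2q)} f = T_{ρ̃/√q} f̃`; Thm 4.1;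
`D_{S,x} f̃ = 2^{-|S|/2} T_{1/√2} D_{S,x} f` (Lemma 2.2) and the contraction give
`‖D_{S,x} f̃‖₂^{q-2} ≤ ((r/√2)^{|S|} γ)^{q-2}`; the bracket is `≤ 1`; `∑_S E_x ‖D_{S,x} f̃‖₂² = ‖f‖₂²` (Lemma 4.6).
[cite: KellerLifshitzMarcus2023, Thm. 4.5] -/
theorem lqPow_noiseOn_le_of_isL2Global [∀ i, Nonempty (α i)] {r γ q ρt : ℝ} (hq : 2 < q) (hr : 0 < r)
    (hγ : 0 < γ) (hρt0 : 0 < ρt) (hρt1 : ρt ≤ 1)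
    (hβ : klmBeta q ρt ≤ Real.sqrt q * (r / Real.sqrt 2) ^ (-(q - 2) / q))
    (f : ((i : ι) → α i) → ℝ) (hglob : IsL2Global r γ f)
    (h41 : HcEstimate q ρt (noiseOn (1 / Real.sqrt 2) univ f)) :
    lqPow q (noiseOn (ρt / Real.sqrt (2 * q)) univ f) ≤ l2sq f * γ ^ (q - 2) := by
  have hq0 : 0 < q := by linarith
  have hq2 : (0 : ℝ) ≤ q - 2 := by linarith
  have hs2 : 0 < Real.sqrt 2 := Real.sqrt_pos.2 (by norm_num)
  have hsq : 0 < Real.sqrt q := Real.sqrt_pos.2 hq0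
  set ft := noiseOn (1 / Real.sqrt 2) univ f with hft
  -- `T_{ρ̃/√(2q)} f = T_{ρ̃/√q} f̃`
  have hsemi : noiseOn (ρt / Real.sqrt (2 * q)) univ f = noiseOn (ρt / Real.sqrt q) univ ft := by
    rw [hft, noiseOn_noiseOn]
    congr 1
    rw [Real.sqrt_mul (by norm_num : (0 : ℝ) ≤ 2)]
    field_simp
  rw [hsemi]
  refine h41.trans ?_
  -- termwise bound
  have hβ0 : 0 ≤ klmBeta q ρt := klmBeta_nonneg hq.le hρt0.le hρt1
  set β := klmBeta q ρt with hβdef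
  have hterm : ∀ (S : Finset ι) (y : (i : ι) → α i),
      l2sq (deriv S y ft) ^ (q / 2) ≤ ((r ^ 2 / 2) ^ S.card * γ ^ 2) ^ ((q - 2) / 2) * l2sq (deriv S y ft) := by
    intro S y
    have hx : 0 ≤ l2sq (deriv S y ft) := l2sq_nonneg _
    rw [rpow_half_split hx hq.le]
    refine mul_le_mul_of_nonneg_right ?_ hx
    refine Real.rpow_le_rpow hx ?_ (by linarith)
    -- `‖D_{S,y} f̃‖₂² = 2^{-|S|} ‖T_{1/√2} D_{S,y} f‖₂² ≤ 2^{-|S|} ‖D_{S,y} f‖₂² ≤ 2^{-|S|} r^{2|S|} γ²`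
    have hD : deriv S y ft = fun x => (1 / Real.sqrt 2) ^ (S ∩ univ).card * noiseOn (1 / Real.sqrt 2) univ (deriv S y f) x := by
      rw [hft, deriv_noiseOn]
    rw [hD, l2sq_smul, Finset.inter_univ]
    have hc : |(1 : ℝ) / Real.sqrt 2| ≤ 1 := by
      rw [abs_of_pos (by positivity), div_le_one hs2]
      have := Real.sqrt_le_sqrt (by norm_num : (1 : ℝ) ≤ 2)
      rwa [Real.sqrt_one] at this
    have h1 := l2sq_noiseOn_le hc univ (deriv S y f)
    have h2 := hglob S y
    have hpow : (((1 : ℝ) / Real.sqrt 2) ^ S.card) ^ 2 = (1 / 2) ^ S.card := by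
      rw [← pow_mul, mul_comm, pow_mul, div_pow, one_pow, Real.sq_sqrt (by norm_num : (0 : ℝ) ≤ 2)]
    rw [hpow]
    calc ((1 : ℝ) / 2) ^ S.card * l2sq (noiseOn (1 / Real.sqrt 2) univ (deriv S y f))
        ≤ (1 / 2) ^ S.card * (r ^ S.card * γ) ^ 2 :=
          mul_le_mul_of_nonneg_left (h1.trans h2) (by positivity)
      _ = (r ^ 2 / 2) ^ S.card * γ ^ 2 := by
          rw [mul_pow, ← pow_mul, div_pow, div_pow, one_pow, ← pow_mul, mul_comm 2 S.card]; ring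
  -- sum the termwise bounds
  have hsum : ∑ S : Finset ι, β ^ (q * S.card) * q ^ (-(q * S.card) / 2) *
        mean (fun y => l2sq (deriv S y ft) ^ (q / 2)) ≤
      ∑ S : Finset ι, (β ^ q * q ^ (-q / 2) * (r ^ 2 / 2) ^ ((q - 2) / 2)) ^ S.card * γ ^ (q - 2) *
        mean (fun y => l2sq (deriv S y ft)) := by
    refine Finset.sum_le_sum fun S _ => ?_
    have hcoef : 0 ≤ β ^ (q * S.card) * q ^ (-(q * S.card) / 2) := by positivity
    calc β ^ (q * S.card) * q ^ (-(q * S.card) / 2) * mean (fun y => l2sq (deriv S y ft) ^ (q / 2))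
        ≤ β ^ (q * S.card) * q ^ (-(q * S.card) / 2) *
            mean (fun y => ((r ^ 2 / 2) ^ S.card * γ ^ 2) ^ ((q - 2) / 2) * l2sq (deriv S y ft)) :=
          mul_le_mul_of_nonneg_left (mean_mono fun y => hterm S y) hcoef
      _ = (β ^ q * q ^ (-q / 2) * (r ^ 2 / 2) ^ ((q - 2) / 2)) ^ S.card * γ ^ (q - 2) *
            mean (fun y => l2sq (deriv S y ft)) := by
          rw [mean_smul, ← mul_assoc, coef_bookkeeping hβ0 hq0 hr hγ S.card]
  refine hsum.trans ?_
  -- bracket ≤ 1 and Lemma 4.6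
  have hbr := bracket_le_one hq hr hβ0 hβ
  have hbr0 : 0 ≤ β ^ q * q ^ (-q / 2) * (r ^ 2 / 2) ^ ((q - 2) / 2) := by positivity
  calc ∑ S : Finset ι, (β ^ q * q ^ (-q / 2) * (r ^ 2 / 2) ^ ((q - 2) / 2)) ^ S.card * γ ^ (q - 2) *
        mean (fun y => l2sq (deriv S y ft))
      ≤ ∑ S : Finset ι, 1 * γ ^ (q - 2) * mean (fun y => l2sq (deriv S y ft)) := by
        refine Finset.sum_le_sum fun S _ => ?_
        refine mul_le_mul_of_nonneg_right (mul_le_mul_of_nonneg_right (pow_le_one₀ hbr0 hbr) ?_) ?_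
        · positivity
        · exact mean_nonneg fun y => l2sq_nonneg _
    _ = γ ^ (q - 2) * ∑ S : Finset ι, l2sq (lap S ft) := by
        rw [Finset.mul_sum]
        exact Finset.sum_congr rfl fun S _ => by rw [one_mul, mean_l2sq_deriv]
    _ = γ ^ (q - 2) * l2sq f := by rw [hft, sum_l2sq_lap_noiseOn]
    _ = l2sq f * γ ^ (q - 2) := mul_comm _ _

/-! ## KLM Lemma 4.9: restriction-globalness gives derivative-globalness -/

/-- `‖f‖₂` via the Euclidean norm of the value vector: `‖f‖₂ = ‖f‖_{ℓ²} / |X|^{1/2}`. [folklore] -/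
private theorem l2n_eq_norm_div [∀ i, Nonempty (α i)] (f : ((i : ι) → α i) → ℝ) :
    l2n f = ‖(WithLp.toLp 2 f : EuclideanSpace ℝ ((i : ι) → α i))‖ / Real.sqrt (cardX α) := by
  unfold l2n l2sq mean
  rw [EuclideanSpace.norm_eq, Real.sqrt_div' _ cardX_pos.le]
  congr 1
  congr 1
  exact Finset.sum_congr rfl fun x _ => by simp [sq_abs]

/-- **Triangle inequality for `‖·‖₂`** over a finite sum of functions.
[cite: KellerLifshitzMarcus2023, Lemma 4.9 (proof: "By the triangle inequality")] -/
theorem l2n_finset_sum_le [∀ i, Nonempty (α i)] {κ : Type*} (s : Finset κ)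
    (F : κ → ((i : ι) → α i) → ℝ) : l2n (fun x => ∑ k ∈ s, F k x) ≤ ∑ k ∈ s, l2n (F k) := by
  rw [l2n_eq_norm_div]
  simp_rw [l2n_eq_norm_div]
  rw [← Finset.sum_div]
  refine div_le_div_of_nonneg_right ?_ (Real.sqrt_nonneg _)
  have : (WithLp.toLp 2 (fun x => ∑ k ∈ s, F k x) : EuclideanSpace ℝ ((i : ι) → α i)) =
      ∑ k ∈ s, (WithLp.toLp 2 (F k) : EuclideanSpace ℝ ((i : ι) → α i)) := by
    ext x; simp
  rw [this]
  exact norm_sum_le _ _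

/-- `l2n f ≤ c ↔ l2sq f ≤ c²` for `c ≥ 0`. [folklore] -/
private theorem l2n_le_iff [∀ i, Nonempty (α i)] {f : ((i : ι) → α i) → ℝ} {c : ℝ} (hc : 0 ≤ c) :
    l2n f ≤ c ↔ l2sq f ≤ c ^ 2 := by
  unfold l2n
  rw [Real.sqrt_le_left hc]

/-- **Jensen for `E_T`, `p = 2`**: `‖E_T g‖₂² ≤ ‖g‖₂²`. [cite: KellerLifshitzMarcus2023, Lemma 4.9 (proof: "we obtain by Jensen's inequality")] -/
theorem l2sq_condAvg_le [∀ i, Nonempty (α i)] (T : Finset ι) (g : ((i : ι) → α i) → ℝ) :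
    l2sq (condAvg T g) ≤ l2sq g := by
  -- pointwise `(E_T g)(x)² ≤ E_T (g²)(x)` (Cauchy–Schwarz), then `E E_T = E`
  have hpt : ∀ x, condAvg T g x ^ 2 ≤ condAvg T (fun z => g z ^ 2) x := by
    intro x
    unfold condAvg
    rw [div_pow, div_le_div_iff₀ (pow_pos cardX_pos 2) cardX_pos, sq (cardX α), ← mul_assoc]
    refine mul_le_mul_of_nonneg_right ?_ cardX_pos.le
    have hcs := Finset.sum_mul_sq_le_sq_mul_sq (univ : Finset ((i : ι) → α i)) (fun _ => (1 : ℝ))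
      (fun y => g (T.piecewise y x))
    simp only [one_mul, one_pow, Finset.sum_const, Finset.card_univ, nsmul_eq_mul, mul_one] at hcs
    rw [← cardX] at hcs
    linarith
  calc l2sq (condAvg T g) = mean (fun x => condAvg T g x ^ 2) := rfl
    _ ≤ mean (condAvg T (fun z => g z ^ 2)) := mean_mono hpt
    _ = mean (fun z => g z ^ 2) := mean_condAvg T _
    _ = l2sq g := rfl

/-- **Jensen for `E_T`, `p = 1`**: `‖E_T g‖₁ ≤ ‖g‖₁`. [cite: KellerLifshitzMarcus2023, Lemma 4.9 (proof)] -/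
theorem l1_condAvg_le [∀ i, Nonempty (α i)] (T : Finset ι) (g : ((i : ι) → α i) → ℝ) :
    mean (fun x => |condAvg T g x|) ≤ mean (fun x => |g x|) := by
  have hpt : ∀ x, |condAvg T g x| ≤ condAvg T (fun z => |g z|) x := by
    intro x
    unfold condAvg
    rw [abs_div, abs_of_pos cardX_pos]
    exact div_le_div_of_nonneg_right (Finset.abs_sum_le_sum_abs _ _) cardX_pos.le
  calc mean (fun x => |condAvg T g x|) ≤ mean (condAvg T (fun z => |g z|)) := mean_mono hpt
    _ = mean (fun z => |g z|) := mean_condAvg T _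

/-- The derivative expands over restricted averages: `D_{S,y} f = ∑_{T ⊆ S} (-1)^{|T|} E_T (f_{S∖T → y})`
(`(E_T f)_{S→y} = E_T(f_{S∖T→y})` since `E_T f` does not depend on `T` and restriction on `S ∖ T` commutes
with `E_T`). [cite: KellerLifshitzMarcus2023, Lemma 4.9 (proof: "`L_S[f] = ∑_{T ⊆ S} (-1)^{|T|} E_T[f]`")] -/
theorem deriv_eq_sum_condAvg_restr [∀ i, Nonempty (α i)] (S : Finset ι) (y : (i : ι) → α i)
    (f : ((i : ι) → α i) → ℝ) :
    deriv S y f = fun x => ∑ T ∈ S.powerset, (-1 : ℝ) ^ T.card * condAvg T (restr (S \ T) y f) x := by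
  unfold deriv lap
  rw [show (fun x => ∑ R ∈ S.powerset, (-1 : ℝ) ^ R.card * condAvg R f x) =
      fun x => ∑ R ∈ S.powerset, (fun x => (-1 : ℝ) ^ R.card * condAvg R f x) x from rfl, restr_finset_sum]
  funext x
  refine Finset.sum_congr rfl fun T hT => ?_
  rw [Finset.mem_powerset] at hT
  rw [restr_smul]
  simp only
  congr 1
  -- `restr S y (E_T f) = restr (S \ T) y (restr T y (E_T f)) = restr (S \ T) y (E_T f) = E_T (restr (S\T) y f)`
  have h1 : restr S y (condAvg T f) = restr (S \ T) y (restr T y (condAvg T f)) := by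
    rw [restr_restr, Finset.sdiff_union_of_subset hT]
  have h2 : restr T y (condAvg T f) = condAvg T f := (dependsOff_condAvg T f).restr_eq le_rfl y
  have h3 : restr (S \ T) y (condAvg T f) = condAvg T (restr (S \ T) y f) :=
    restr_condAvg Finset.sdiff_disjoint y f
  rw [h1, h2, h3]

/-- **KLM Lemma 4.9, `p = 1`**: restriction-globalness `‖f_{S→x}‖₁ ≤ r^{|S|} γ₁` (`|S| ≤ d`, `r ≥ 1`)
gives `(2r, γ₁, d)`-`L¹`-globalness. [cite: KellerLifshitzMarcus2023, Lemma 4.9] -/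
theorem isL1GlobalD_of_isRestrGlobal [∀ i, Nonempty (α i)] {r γ₁ γ₂ : ℝ} {d : ℕ}
    {f : ((i : ι) → α i) → ℝ} (hr : 1 ≤ r) (hγ₁ : 0 ≤ γ₁) (h : IsRestrGlobal r γ₁ γ₂ d f) :
    IsL1GlobalD (2 * r) γ₁ d f := by
  intro S hS y
  rw [deriv_eq_sum_condAvg_restr]
  -- `E|∑_T ± E_T(f_{S\T→y})| ≤ ∑_T E|E_T(…)| ≤ ∑_T ‖f_{S\T→y}‖₁ ≤ ∑_T r^{|S\T|} γ₁ ≤ 2^{|S|} r^{|S|} γ₁`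
  calc mean (fun x => |∑ T ∈ S.powerset, (-1 : ℝ) ^ T.card * condAvg T (restr (S \ T) y f) x|)
      ≤ mean (fun x => ∑ T ∈ S.powerset, |condAvg T (restr (S \ T) y f) x|) := by
        refine mean_mono fun x => (Finset.abs_sum_le_sum_abs _ _).trans (le_of_eq ?_)
        exact Finset.sum_congr rfl fun T _ => by rw [abs_mul, abs_pow, abs_neg, abs_one, one_pow, one_mul]
    _ = ∑ T ∈ S.powerset, mean (fun x => |condAvg T (restr (S \ T) y f) x|) := mean_finset_sum _ _
    _ ≤ ∑ T ∈ S.powerset, r ^ S.card * γ₁ := by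
        refine Finset.sum_le_sum fun T hT => ?_
        rw [Finset.mem_powerset] at hT
        refine (l1_condAvg_le T _).trans ?_
        have hcard : (S \ T).card ≤ d := (Finset.card_le_card Finset.sdiff_subset).trans hS
        refine ((h (S \ T) hcard y).1).trans ?_
        exact mul_le_mul_of_nonneg_right (pow_le_pow_right₀ hr (Finset.card_le_card Finset.sdiff_subset)) hγ₁
    _ = (2 * r) ^ S.card * γ₁ := by
        rw [Finset.sum_const, Finset.card_powerset, nsmul_eq_mul, mul_pow]
        push_cast
        ring

/-- **KLM Lemma 4.9, `p = 2`**: restriction-globalness `‖f_{S→x}‖₂ ≤ r^{|S|} γ₂` (`|S| ≤ d`, `r ≥ 1`)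
gives `(2r, γ₂, d)`-`L²`-globalness. [cite: KellerLifshitzMarcus2023, Lemma 4.9] -/
theorem isL2GlobalD_of_isRestrGlobal [∀ i, Nonempty (α i)] {r γ₁ γ₂ : ℝ} {d : ℕ}
    {f : ((i : ι) → α i) → ℝ} (hr : 1 ≤ r) (hγ₂ : 0 ≤ γ₂) (h : IsRestrGlobal r γ₁ γ₂ d f) :
    IsL2GlobalD (2 * r) γ₂ d f := by
  intro S hS y
  have hc : 0 ≤ (2 * r) ^ S.card * γ₂ := by positivity
  rw [← l2n_le_iff hc, deriv_eq_sum_condAvg_restr]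
  calc l2n (fun x => ∑ T ∈ S.powerset, (-1 : ℝ) ^ T.card * condAvg T (restr (S \ T) y f) x)
      ≤ ∑ T ∈ S.powerset, l2n (fun x => (-1 : ℝ) ^ T.card * condAvg T (restr (S \ T) y f) x) :=
        l2n_finset_sum_le _ _
    _ ≤ ∑ T ∈ S.powerset, r ^ S.card * γ₂ := by
        refine Finset.sum_le_sum fun T hT => ?_
        rw [Finset.mem_powerset] at hT
        have hc' : 0 ≤ r ^ S.card * γ₂ := by positivity
        rw [l2n_le_iff hc', l2sq_smul, show ((-1 : ℝ) ^ T.card) ^ 2 = 1 by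
          rw [← pow_mul, mul_comm, pow_mul]; simp, one_mul]
        refine (l2sq_condAvg_le T _).trans ?_
        have hcard : (S \ T).card ≤ d := (Finset.card_le_card Finset.sdiff_subset).trans hS
        refine ((h (S \ T) hcard y).2).trans ?_
        have : r ^ (S \ T).card * γ₂ ≤ r ^ S.card * γ₂ :=
          mul_le_mul_of_nonneg_right (pow_le_pow_right₀ hr (Finset.card_le_card Finset.sdiff_subset)) hγ₂
        exact pow_le_pow_left₀ (by positivity) this 2
    _ = (2 * r) ^ S.card * γ₂ := by
        rw [Finset.sum_const, Finset.card_powerset, nsmul_eq_mul, mul_pow]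
        push_cast
        ring

end Literature.Combinatorics.Additive.ProductSpace
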